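import Summits.AtomisticToContinuum.FouriersLaw.Theorems.BondHeatUncertaintyExtensiveSnapshotIrreversibilityEnergyWindowHarrisResponseA

/-!
# «EnergyWindowHarrisResponse» (lens-1 g74 node K: S3 KernelTemperatureLipschitz, S3m, S1 EquilibriumSkeletonHarris PROVED at equilibrium, S3 ⟹ S3m telescoping, seam S1 → S3m → A1⁺ → A3i_TV) — part 2 of 3 (sequel of `…BondHeatUncertaintyExtensiveSnapshotIrreversibilityEnergyWindowHarrisResponseA`)

Split for the 400-line cap by the landing lane (hand-2 g30); the module docstring of part 1 (`…BondHeatUncertaintyExtensiveSnapshotIrreversibilityEnergyWindowHarrisResponseA`) describes the whole node.  Same namespace; all FQNs unchanged.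
0 sorry; standard axioms.
-/

noncomputable section

namespace Summit.AtomisticToContinuum.FouriersLaw.Theorems.ExtensiveSnapshotIrreversibility.EnergyWindow

open MeasureTheory ProbabilityTheory Filter Topology Real
open scoped ENNReal NNReal
open Literature.MathematicalPhysics.KineticTheory.HeatConduction
open Literature.Probability.Process

variable {N : ℕ}

/-! ## 4. S3 ⟹ S3m: telescoping over unit time steps with CEHR (3.4) -/

/-- **S3 ⟹ S3m.**  By induction on the integer time `j`:
`P^δ_{j+1} h − P_{j+1} h = P^δ_1 (P^δ_j h − P_j h) + (P^δ_1 − P_1)(P_j h)` (Chapman–Kolmogorov,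
`pinnedChain_transitionKernel_add`), where `|P^δ_j h − P_j h| ≤ C_j|δ| e^{θ'H}` (induction),
`P^δ_1 e^{θ'H} ≤ e^{2θ'γT} e^{θ'H}` (CEHR (3.4) at `(T+δ/2, T−δ/2)`: the constant only sees
`T_L + T_R = 2T`, `|δ|` small so that `θ' < 1/max(T ± δ/2)`), and `|P_j h| ≤ e^{2θγTj} e^{θH}`
((3.4) at `(T,T)`) so that S3 applies to `P_j h / e^{2θγTj}`; `C_{j+1} = C_j e^{2θ'γT} +
C e^{2θγTj}`. [cite: CuneoEckmannHairerReyBellet2018, §3 eq. (3.4)] -/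
theorem kernelTemperatureLipschitzSkeleton_of_kernelTemperatureLipschitz
    (h3 : KernelTemperatureLipschitz) : KernelTemperatureLipschitzSkeleton := by
  intro ω₂ lam β γ hω hl hβ hγ T hT N hN θ θ' hθ hθθ' hθ'1 m
  have hN0 : 0 < N := lt_of_lt_of_le (by norm_num) hN
  have hθ' : 0 < θ' := hθ.trans hθθ'
  have hθ1 : θ < 1 / T := hθθ'.trans hθ'1
  have hTθ' : T < 1 / θ' := (lt_one_div hθ' hT).1 hθ'1
  have hθTT : θ < 1 / max T T := by rw [max_self]; exact hθ1
  obtain ⟨δ₀, C, hδ₀, hlip⟩ := h3 ω₂ lam β γ hω hl hβ hγ T hT N hN θ θ' hθ hθθ' hθ'1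
  set Hm := (pinnedChain ω₂ lam β γ).hamiltonian N with hHm
  -- the δ-range: S3's `δ₀`, positive temperatures, and `θ' < 1/max(T ± δ/2)`
  set δ₁ : ℝ := min δ₀ (min T (1 / θ' - T)) with hδ₁
  have hδ₁0 : 0 < δ₁ := lt_min hδ₀ (lt_min hT (by linarith))
  -- the claim, by induction on the integer time, with a nonnegative constant
  suffices key : ∀ j : ℕ, ∃ Cj : ℝ, 0 ≤ Cj ∧ ∀ δ : ℝ, |δ| < δ₁ →
      ∀ (z : PhaseSpace N) (h : PhaseSpace N → ℝ), Measurable h →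
        (∀ y, |h y| ≤ Real.exp (θ * Hm y)) →
        |∫ y, h y ∂((pinnedChain ω₂ lam β γ).transitionKernel N (T + δ / 2) (T - δ / 2) j z) -
            ∫ y, h y ∂((pinnedChain ω₂ lam β γ).transitionKernel N T T j z)| ≤
          Cj * |δ| * Real.exp (θ' * Hm z) by
    obtain ⟨Cm, -, hCm⟩ := key m
    exact ⟨δ₁, Cm, hδ₁0, hCm⟩
  intro j
  induction j with
  | zero =>
    refine ⟨0, le_rfl, fun δ _ z h _ _ => ?_⟩
    have e1 := integral_transitionKernel_zero hω hl hβ hγ (T + δ / 2) (T - δ / 2) z h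
    have e2 := integral_transitionKernel_zero hω hl hβ hγ T T z h
    simp only [Nat.cast_zero, e1, e2, sub_self, abs_zero, zero_mul, le_refl]
  | succ j ih =>
    obtain ⟨Cj, hCj0, hj⟩ := ih
    -- the (3.4) growth constants at time `1` (perturbed pair) and time `j` (equilibrium pair)
    set E₁ : ℝ := Real.exp (θ' * γ * (2 * T) * (1 : ℝ≥0)) with hE₁
    set Lj : ℝ := Real.exp (θ * γ * (T + T) * (j : ℝ≥0)) with hLj
    have hLj0 : 0 < Lj := Real.exp_pos _
    refine ⟨Cj * E₁ + max C 0 * Lj, by positivity, fun δ hδ z h hhm hh => ?_⟩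
    have hδ0' : |δ| < δ₀ := hδ.trans_le (min_le_left _ _)
    have hδT : |δ| < T := (hδ.trans_le (min_le_right _ _)).trans_le (min_le_left _ _)
    have hδθ : |δ| < 1 / θ' - T := (hδ.trans_le (min_le_right _ _)).trans_le (min_le_right _ _)
    obtain ⟨hδa, hδb⟩ := abs_lt.1 hδT
    obtain ⟨hδc, hδd⟩ := abs_lt.1 hδθ
    have hTL : 0 < T + δ / 2 := by linarith
    have hTR : 0 < T - δ / 2 := by linarith
    have hmax0 : 0 < max (T + δ / 2) (T - δ / 2) := lt_max_of_lt_left hTL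
    have hθ'max : θ' < 1 / max (T + δ / 2) (T - δ / 2) :=
      (lt_one_div hθ' hmax0).2 (max_lt (by linarith) (by linarith))
    have hsum : T + δ / 2 + (T - δ / 2) = 2 * T := by ring
    -- the inner functions `F^δ_j = P^δ_j h`, `F_j = P_j h`
    set Fδ : PhaseSpace N → ℝ := fun w =>
      ∫ y, h y ∂((pinnedChain ω₂ lam β γ).transitionKernel N (T + δ / 2) (T - δ / 2) j w) with hFδ
    set F : PhaseSpace N → ℝ := fun w =>
      ∫ y, h y ∂((pinnedChain ω₂ lam β γ).transitionKernel N T T j w) with hF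
    have hFδm : Measurable Fδ := (hhm.stronglyMeasurable.integral_kernel
      (κ := (pinnedChain ω₂ lam β γ).transitionKernel N (T + δ / 2) (T - δ / 2) j)).measurable
    have hFm : Measurable F := (hhm.stronglyMeasurable.integral_kernel
      (κ := (pinnedChain ω₂ lam β γ).transitionKernel N T T j)).measurable
    have hh1 : ∀ y, |h y| ≤ 1 * Real.exp (θ * Hm y) := fun y => by rw [one_mul]; exact hh y
    -- `|F_j| ≤ L_j e^{θH}` by (3.4) at `(T,T)`
    have hFb : ∀ w, |F w| ≤ Lj * Real.exp (θ * Hm w) := fun w => by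
      have := (integrable_and_abs_integral_transitionKernel_le hω hl hβ hγ hN0 hT hT hθ hθTT
        (j : ℝ≥0) w zero_le_one hhm hh1).2
      rw [one_mul] at this
      exact this
    -- the pointwise difference `|F^δ_j − F_j| ≤ C_j |δ| e^{θ'H}` (induction hypothesis)
    have hdiff : ∀ w, |Fδ w - F w| ≤ Cj * |δ| * Real.exp (θ' * Hm w) := fun w =>
      hj δ hδ w h hhm hh
    -- integrability of `h` at time `j+1` (both pairs), hence Chapman–Kolmogorov
    have hcast : ((j + 1 : ℕ) : ℝ≥0) = (1 : ℝ≥0) + (j : ℝ≥0) := by push_cast; ring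
    have hintδ : Integrable h
        ((pinnedChain ω₂ lam β γ).transitionKernel N (T + δ / 2) (T - δ / 2) ((1 : ℝ≥0) + j) z) :=
      (integrable_and_abs_integral_transitionKernel_le hω hl hβ hγ hN0 hTL hTR hθ
        (hθθ'.trans hθ'max) _ z zero_le_one hhm hh1).1
    have hint0 : Integrable h ((pinnedChain ω₂ lam β γ).transitionKernel N T T ((1 : ℝ≥0) + j) z) :=
      (integrable_and_abs_integral_transitionKernel_le hω hl hβ hγ hN0 hT hT hθ hθTT _ z
        zero_le_one hhm hh1).1
    rw [hcast, integral_transitionKernel_add hω hl hβ hγ _ _ 1 j z hintδ,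
      integral_transitionKernel_add hω hl hβ hγ _ _ 1 j z hint0]
    change |∫ w, Fδ w ∂((pinnedChain ω₂ lam β γ).transitionKernel N (T + δ / 2) (T - δ / 2) 1 z) -
        ∫ w, F w ∂((pinnedChain ω₂ lam β γ).transitionKernel N T T 1 z)| ≤ _
    -- split: `P^δ_1 (F^δ − F) + (P^δ_1 − P_1) F`
    have hI1 := integrable_and_abs_integral_transitionKernel_le hω hl hβ hγ hN0 hTL hTR hθ'
      hθ'max 1 z (by positivity : 0 ≤ Cj * |δ|) (hFδm.sub hFm) hdiff
    have hIF : Integrable F ((pinnedChain ω₂ lam β γ).transitionKernel N (T + δ / 2) (T - δ / 2) 1 z) :=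
      (integrable_and_abs_integral_transitionKernel_le hω hl hβ hγ hN0 hTL hTR hθ
        (hθθ'.trans hθ'max) 1 z hLj0.le hFm hFb).1
    have hIFδ : Integrable Fδ ((pinnedChain ω₂ lam β γ).transitionKernel N (T + δ / 2) (T - δ / 2) 1 z) :=
      (hI1.1.add hIF).congr (ae_of_all _ fun w => by
        simp only [Pi.add_apply, Pi.sub_apply, sub_add_cancel])
    have hsplit : ∫ w, Fδ w ∂((pinnedChain ω₂ lam β γ).transitionKernel N (T + δ / 2) (T - δ / 2) 1 z) -
        ∫ w, F w ∂((pinnedChain ω₂ lam β γ).transitionKernel N T T 1 z) =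
        ∫ w, (Fδ w - F w) ∂((pinnedChain ω₂ lam β γ).transitionKernel N (T + δ / 2) (T - δ / 2) 1 z) +
          (∫ w, F w ∂((pinnedChain ω₂ lam β γ).transitionKernel N (T + δ / 2) (T - δ / 2) 1 z) -
            ∫ w, F w ∂((pinnedChain ω₂ lam β γ).transitionKernel N T T 1 z)) := by
      rw [integral_sub hIFδ hIF]; ring
    rw [hsplit]
    -- second piece: S3 applied to `F / L_j`
    have hS3 : |∫ w, F w ∂((pinnedChain ω₂ lam β γ).transitionKernel N (T + δ / 2) (T - δ / 2) 1 z) -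
        ∫ w, F w ∂((pinnedChain ω₂ lam β γ).transitionKernel N T T 1 z)| ≤
        max C 0 * Lj * |δ| * Real.exp (θ' * Hm z) := by
      have h := hlip δ hδ0' z (fun w => Lj⁻¹ * F w) (hFm.const_mul _) (fun w => by
        rw [abs_mul, abs_of_pos (inv_pos.2 hLj0), inv_mul_le_iff₀ hLj0]; exact hFb w)
      rw [integral_const_mul, integral_const_mul, ← mul_sub, abs_mul,
        abs_of_pos (inv_pos.2 hLj0), inv_mul_le_iff₀ hLj0] at h
      refine h.trans ?_
      have hC : C ≤ max C 0 := le_max_left _ _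
      have h0 : 0 ≤ |δ| * Real.exp (θ' * Hm z) := by positivity
      calc Lj * (C * |δ| * Real.exp (θ' * Hm z)) = C * (Lj * (|δ| * Real.exp (θ' * Hm z))) := by
            ring
        _ ≤ max C 0 * (Lj * (|δ| * Real.exp (θ' * Hm z))) :=
            mul_le_mul_of_nonneg_right hC (by positivity)
        _ = max C 0 * Lj * |δ| * Real.exp (θ' * Hm z) := by ring
    -- first piece: (3.4) at `(T+δ/2, T−δ/2)`, time `1`, rate `θ'`
    have hP1 : |∫ w, (Fδ w - F w)
        ∂((pinnedChain ω₂ lam β γ).transitionKernel N (T + δ / 2) (T - δ / 2) 1 z)| ≤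
        Cj * |δ| * (E₁ * Real.exp (θ' * Hm z)) := by
      have h := hI1.2
      rw [hsum] at h
      exact h
    calc |∫ w, (Fδ w - F w) ∂((pinnedChain ω₂ lam β γ).transitionKernel N (T + δ / 2) (T - δ / 2) 1 z) +
          (∫ w, F w ∂((pinnedChain ω₂ lam β γ).transitionKernel N (T + δ / 2) (T - δ / 2) 1 z) -
            ∫ w, F w ∂((pinnedChain ω₂ lam β γ).transitionKernel N T T 1 z))|
        ≤ Cj * |δ| * (E₁ * Real.exp (θ' * Hm z)) + max C 0 * Lj * |δ| * Real.exp (θ' * Hm z) :=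
          (abs_add_le _ _).trans (add_le_add hP1 hS3)
      _ = (Cj * E₁ + max C 0 * Lj) * |δ| * Real.exp (θ' * Hm z) := by ring

end Summit.AtomisticToContinuum.FouriersLaw.Theorems.ExtensiveSnapshotIrreversibility.EnergyWindow

end
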